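import Summits.BirchSwinnertonDyer.BirchSwinnertonDyer.Theorems.GenusKolyvaginAtTwoGenusPrimitiveSupplyAtTwoTwistingPrimeDepthKolyvagin
import Summits.BirchSwinnertonDyer.BirchSwinnertonDyer.Theorems.GenusKolyvaginAtTwoGenusPrimitiveSupplyAtTwoConjugationTypeAtTwoNeg
import Literature.NumberTheory.GaloisRepresentations.FrobeniusGeneration
import Literature.NumberTheory.EllipticCurves.HeegnerPointsKolyvaginLocalCriterion
import HarnessLib

/-!
# Route `GenusKolyvaginAtTwo`, crux #2 `GenusPrimitiveSupplyAtTwo` (stmt-BirchSwinnertonDyer-22136):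
# ENTANGLED classes are STRICT at every depth-`M` Kolyvagin prime (local part: `H¹(⟨c₀⟩, E[2]) = 0`, the local criterion
# for an inflated class, and its `ℚ`-instance at `FrobEqFrobInfty W K (2^M) ℓ`)

Width seat `bsd-line-gk2-p4` g9 (cell `bsd-f1-sign2`), twelfth file of the twisting-prime series, first of two (crux workfile
`Lines/genus-supply-depth-class.md` §2). THEOREMS ONLY (no definition, no named fact, no `sorry`); helper
`--supports stmt-BirchSwinnertonDyer-22136`; no item is closed; BSD is not proved by any of this.

WHY. g8's habitat capstone (`exists_kolyvaginPrime_depthTwo_genusPair_selmer_of_cor34i_of_half`, p623549) supplies the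
auxiliary-field form of U (p615396) with a depth-`2` Kolyvagin prime `ℓ` and a `Sel₂`-trivial even genus twist `Wd^{(−ℓ)}`,
under ONE point condition on the row-1 twin `Wd = A`: a half of its generator is MOVED by `Γ_{ℚ(E[4])}` («not entangled»;
DES13: 508/510). g8's memo recorded the converse as a remark («an entangled class is strict at EVERY depth-2 Kolyvagin prime;
H¹(⟨c₀⟩, E[2]) = 0; not kernel»). This file makes it kernel and composes it with the strict-inheritance of
`…TwistSelmerStrictInherit` (this seat): for an ENTANGLED twin the depth-`2` supply FAILS AT EVERY depth-`2` Kolyvagin prime —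
so the point condition is NECESSARY, and the depth-`2` auxiliary-field road is closed on exactly the entangled cells (where
g7's depth-one supply remains).

* §30 `exists_eq_smul_sub_of_smul_eq_of_Δ_neg` — `Δ < 0`: a `2`-torsion point FIXED by complex conjugation `c₀` is of the
  form `c₀Q − Q` (`H¹(⟨c₀⟩, E[2]) = 0`: `E[2] ≅ 𝔽₂[C₂]` is free; from the sibling count `#E[2]^{c₀} = 2`).
* §31 `mem_torsionLocalKer_of_forall_h1Eval_eq_zero_of_frob` — the LOCAL CRITERION for a class that DIES on an open normal
  subgroup `T ≤ Γ_{ℚ(V[2])}` (e.g. `T = Γ_{ℚ(E[2^M])}`), at a place whose Frobenius is `c·t` with `t ∈ T`, `c² = 1`,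
  `V[2]^c = (c − 1)V[2]`, and whose inertia lies in `T`: the class is STRICT there (`x_v = 0`). Cocycle algebra on
  `G_𝔓 = ⋃ Fᵏ·I·T` (`FrobeniusGeneration`): `φ(F) = φ(c) = cQ − Q = FQ − Q`, `φ|_{I·T} = 0`, so `φ|_{G_𝔓} = ∂Q`.
* §32 `selmerGroup_le_strictLocalKer_twist_of_forall_h1Eval_eq_zero` — over `ℚ`, `Δ_W < 0`, `Wd` any model of `W^{(d)}`, `ℓ ∤ 2N_W`
  a prime with `FrobEqFrobInfty W K (2^M) ℓ`: if EVERY class of `Sel₂(Wd)` dies on `Γ_{ℚ(E[2^M])}` (the negation of the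
  twin-side hypothesis `hS'` of g8's `exists_kolyvaginPrime_pow_genusPair_selmer_of_cor34i`), then
  `Sel₂(Wd) ≤ strictLocalKer Wd ℚ_ℓ 2`.
* (sibling `…TwistingPrimeDepthEntangled.lean`, §33) the ENTANGLED CAPSTONES composing §32 with
  `GenusKolyTwistLocal.two_dvd_natCard_selmerGroup_twin_of_le_strictLocalKer`: at every candidate prime the even genus twist of
  an entangled twin has EVEN `#Sel₂`, never `1` — the point condition of p623549 is necessary.

References: [MazurRubin2010] Def. 3.1, Prop. 3.3, Cor. 3.4 (i), Lemma 3.5; [GrossLMS1991] §9 Prop. 9.6; [McCallumLMS1991] §3 (3);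
[LawsonWuthrich2016] Lemma 6, Thm. 1 (the inflated class at `2`); [SerreGaloisCohomology1997] I §2, I §5.
-/

set_option linter.dupNamespace false -- tree convention: `Summit.BirchSwinnertonDyer.BirchSwinnertonDyer.Theorems` (summit = sub-problem)
set_option autoImplicit false

noncomputable section

open scoped Classical Pointwise

namespace Summit.BirchSwinnertonDyer.BirchSwinnertonDyer.Theorems.GenusKolyTwistingPrime

open WeierstrassCurve NumberField IsDedekindDomain Field
open Literature.NumberTheory.GaloisRepresentations Literature.NumberTheory.EllipticCurves
open Literature.NumberTheory

/-! ## §30 `Δ < 0`: `H¹(⟨c₀⟩, E[2]) = 0` — fixed `2`-torsion points are `c₀Q − Q` -/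

section ConjCoboundary

variable (V : WeierstrassCurve ℚ) [V.IsElliptic]

/-- **`Δ < 0` ⟹ `E[2]^{c₀} = (c₀ − 1)E[2]`**: every `2`-torsion point fixed by complex conjugation `c₀` is `c₀ • Q − Q` for some
`Q ∈ E[2]` (`c₀` is a transposition on `E[2] ≅ 𝔽₂²`, i.e. `E[2] ≅ 𝔽₂[C₂]` is free, so `H¹(⟨c₀⟩, E[2]) = 0`). From the sibling
count `natCard_twoTorsion_fixed_eq_two_of_Δ_neg` (`#ker(c₀ − 1) = 2`): the endomorphism `f = c₀ − 1` of the order-`4` group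
`E[2]` has `f ∘ f = 0` (`c₀² = 1`, `2E[2] = 0`), so `im f ≤ ker f`, and `#im f = 4/#ker f = 2 = #ker f`.
[cite: SilvermanAEC2009, Cor. III.6.4(b)] [cite: LawsonWuthrich2016, Lemma 6] -/
theorem exists_eq_smul_sub_of_smul_eq_of_Δ_neg (hΔ : V.Δ < 0) {c₀ : absoluteGaloisGroup ℚ}
    (hc₀ : IsComplexConjugation (Rat.castHom ℝ) c₀) (P : geomTorsion V (2 : ℤ)) (hP : c₀ • P = P) :
    ∃ Q : geomTorsion V (2 : ℤ), P = c₀ • Q - Q := by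
  haveI : Fact (Nat.Prime 2) := ⟨Nat.prime_two⟩
  have hE : Nat.card (geomTorsion V (2 : ℤ)) = 2 ^ 2 :=
    card_torsionPoints_eq_sq_holds V (AlgebraicClosure ℚ) (by norm_num)
  haveI hfin : Finite (geomTorsion V (2 : ℤ)) := Nat.finite_of_card_ne_zero (by rw [hE]; norm_num)
  set f : geomTorsion V (2 : ℤ) →+ geomTorsion V (2 : ℤ) :=
    (DistribSMul.toAddMonoidHom (geomTorsion V (2 : ℤ)) c₀) - AddMonoidHom.id _ with hf
  have hfapply : ∀ Q, f Q = c₀ • Q - Q := fun Q ↦ rfl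
  have hker : ∀ R, R ∈ f.ker ↔ c₀ • R = R := fun R ↦ by
    rw [AddMonoidHom.mem_ker, hfapply, sub_eq_zero]
  -- `#ker f = 2`
  have hcardK : Nat.card f.ker = 2 :=
    (Nat.card_congr (Equiv.subtypeEquivRight fun R ↦ hker R)).trans
      (GenusKolySign.natCard_twoTorsion_fixed_eq_two_of_Δ_neg V hΔ hc₀)
  -- `#range f = 2`
  have hcardR : Nat.card f.range = 2 := by
    have h1 : Nat.card (geomTorsion V (2 : ℤ) ⧸ f.ker) = Nat.card f.range :=
      Nat.card_congr (QuotientAddGroup.quotientKerEquivRange f).toEquiv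
    have h2 := f.ker.card_eq_card_quotient_mul_card_addSubgroup
    rw [hE, h1, hcardK] at h2
    omega
  -- `range f ≤ ker f` (`f ∘ f = 0`)
  have hsq : c₀ * c₀ = 1 := by have h := hc₀.sq_eq_one; rwa [sq] at h
  have h2t : ∀ R : geomTorsion V (2 : ℤ), R + R = 0 := fun R ↦ by
    rw [← two_nsmul]; exact AddSubgroup.torsionBy.nsmul _
  have hle : f.range ≤ f.ker := by
    rintro _ ⟨Q, rfl⟩
    rw [hker, hfapply, smul_sub, ← mul_smul, hsq, one_smul, sub_eq_sub_iff_add_eq_add, h2t, h2t]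
  -- equal cards ⟹ equal
  have heq : f.range = f.ker :=
    AddSubgroup.eq_of_le_of_card_ge hle (by rw [hcardK, hcardR])
  have hPker : P ∈ f.ker := (hker P).mpr hP
  rw [← heq] at hPker
  obtain ⟨Q, hQ⟩ := hPker
  exact ⟨Q, by rw [← hQ, hfapply]⟩

/-- The same for a CONJUGATE `δ c₀ δ⁻¹` of complex conjugation (the Frobenius at the prime cut out by the chosen embedding is
only conjugate to `c₀ · t`). [cite: SilvermanAEC2009, Cor. III.6.4(b)] -/
theorem exists_eq_smul_sub_of_smul_eq_of_Δ_neg_conj (hΔ : V.Δ < 0) {c₀ : absoluteGaloisGroup ℚ}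
    (hc₀ : IsComplexConjugation (Rat.castHom ℝ) c₀) (δ : absoluteGaloisGroup ℚ)
    (P : geomTorsion V (2 : ℤ)) (hP : (δ * c₀ * δ⁻¹) • P = P) :
    ∃ Q : geomTorsion V (2 : ℤ), P = (δ * c₀ * δ⁻¹) • Q - Q := by
  have hP' : c₀ • (δ⁻¹ • P) = δ⁻¹ • P := by
    have h := congrArg (fun R ↦ δ⁻¹ • R) hP
    simp only [mul_smul, inv_smul_smul] at h
    exact h
  obtain ⟨Q, hQ⟩ := exists_eq_smul_sub_of_smul_eq_of_Δ_neg V hΔ hc₀ (δ⁻¹ • P) hP'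
  refine ⟨δ • Q, ?_⟩
  have h := congrArg (fun R ↦ δ • R) hQ
  simp only [smul_inv_smul, smul_sub] at h
  rw [h, mul_smul, mul_smul, inv_smul_smul]

end ConjCoboundary

/-! ## §31 The local criterion for a class DYING on an open normal subgroup, at a Frobenius `c · t` -/

section Local

variable (V : WeierstrassCurve ℚ) {v : HeightOneSpectrum (𝓞 ℚ)}

/-- **A class dying on `T` is STRICT at a place with Frobenius `c·t` (`t ∈ T`), `c` an involution with `V[2]^c = (c−1)V[2]`,
and inertia in `T`.** Let `V/ℚ` be elliptic, `T ≤ Γ_{ℚ(V[2])}` an OPEN NORMAL subgroup of `Γ_ℚ` (e.g. `Γ_{ℚ(E[2^M])}` for a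
curve `E` with `E[2] ≅ V[2]`), `x ∈ H¹(ℚ, V[2])` with `[x, h] = 0` for every `h ∈ T` (the class is inflated from `Γ_ℚ/T`), `v` a
finite place with an arithmetic Frobenius `γ` at some prime `𝔓₀ ∣ v` of the form `γ = c · t`, `t ∈ T`, where `c² = 1` and every
`c`-fixed point of `V[2]` is `cQ − Q` (complex conjugation on `Δ_V < 0`, §30), and every inertia group above `v` lies in `T`
(`v` good for `E`, `v ∤ 2`). THEN `x_v = 0` in `H¹(ℚ_v, V[2])`. Proof: conjugate `γ` to the Frobenius `F = c₁t₁` at the prime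
cut out by `ℚ̄ → ℚ̄_v`; the chosen cocycle `φ` of `x` vanishes on `T`, so `φ(F) = φ(c₁)` and `c₁φ(c₁) = −φ(c₁) = φ(c₁)`, whence
`φ(c₁) = c₁Q − Q = FQ − Q`; every `d ∈ G_𝔓` is `Fᵏ·i·u` with `i ∈ I_𝔓 ≤ T`, `u ∈ T` (`FrobeniusGeneration`), so
`φ(d) = φ(Fᵏ) = FᵏQ − Q = dQ − Q`: `φ|_{G_𝔓}` is the coboundary of `Q`, and the local class vanishes. This is the converse of
the seat's `not_mem_torsionLocalKer_of_h1Eval_sq_ne_zero` (g7) in the entangled case.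
[cite: GrossLMS1991, Prop. 9.6] [cite: McCallumLMS1991, §3 (3)] [cite: LawsonWuthrich2016, Lemma 6] -/
theorem mem_torsionLocalKer_of_forall_h1Eval_eq_zero_of_frob
    (T : Subgroup (absoluteGaloisGroup ℚ)) [T.Normal] (hTopen : IsOpen (T : Set (absoluteGaloisGroup ℚ)))
    (hT : T ≤ torsionFixing V (2 : ℤ))
    {x : galH1Torsion V (2 : ℤ)} (hx : ∀ h ∈ T, h1Eval V (2 : ℤ) x h = 0)
    {𝔓₀ : Ideal (absIntegers (𝓞 ℚ) ℚ)} (h𝔓₀ : 𝔓₀ ∈ v.primesAbove)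
    {γ c : absoluteGaloisGroup ℚ} (hγ : IsArithFrobAt (𝓞 ℚ) γ 𝔓₀) (hcc : c * c = 1) (hct : c⁻¹ * γ ∈ T)
    (hcfix : ∀ (δ : absoluteGaloisGroup ℚ) (P : geomTorsion V (2 : ℤ)), (δ * c * δ⁻¹) • P = P →
      ∃ Q : geomTorsion V (2 : ℤ), P = (δ * c * δ⁻¹) • Q - Q)
    (hI : ∀ 𝔐 ∈ v.localPrimesAbove,
      (v.primeBelow (closureEmb (K := ℚ) (v.adicCompletion ℚ)) 𝔐).inertia (absoluteGaloisGroup ℚ) ≤ T) :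
    x ∈ V.torsionLocalKer (v.adicCompletion ℚ) (2 : ℤ) := by
  classical
  obtain ⟨𝔐, h𝔐⟩ := v.localPrimesAbove_nonempty
  set ι₀ := closureEmb (K := ℚ) (v.adicCompletion ℚ) with hι₀
  set 𝔓w := v.primeBelow ι₀ 𝔐 with h𝔓w_def
  have h𝔓w : 𝔓w ∈ v.primesAbove := v.primeBelow_mem_primesAbove h𝔐
  haveI : 𝔓w.IsPrime := h𝔓w.1
  -- conjugate the Frobenius to the prime cut out by the embedding
  obtain ⟨δ, -, hF⟩ := HeightOneSpectrum.exists_isArithFrobAt_conj_of_mem_primesAbove_holds h𝔓₀ h𝔓w hγ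
  set c₁ : absoluteGaloisGroup ℚ := δ * c * δ⁻¹ with hc₁
  set t₁ : absoluteGaloisGroup ℚ := δ * (c⁻¹ * γ) * δ⁻¹ with ht₁
  have hFct : δ * γ * δ⁻¹ = c₁ * t₁ := by
    rw [hc₁, ht₁]
    have : γ = c * (c⁻¹ * γ) := by group
    conv_lhs => rw [this]
    group
  have ht₁T : t₁ ∈ T := ‹T.Normal›.conj_mem _ hct δ
  have hc₁c₁ : c₁ * c₁ = 1 := by
    rw [hc₁, show δ * c * δ⁻¹ * (δ * c * δ⁻¹) = δ * (c * c) * δ⁻¹ by group, hcc]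
    group
  -- the chosen cocycle of `x` and its identities
  set φ := reprCocycle V (2 : ℤ) x with hφ
  have hφT : ∀ h ∈ T, φ.1 h = 0 := hx
  have hcoc : ∀ a b : absoluteGaloisGroup ℚ, φ.1 (a * b) = φ.1 a + a • φ.1 b := fun a b ↦ by
    have h := φ.2 a b
    rwa [discreteTopRep_ρ_apply] at h
  have hφ1 : φ.1 1 = 0 := contOneCocycles.apply_one φ
  have hfixT : ∀ h ∈ T, ∀ Q : geomTorsion V (2 : ℤ), h • Q = Q := fun h hh Q ↦
    smul_eq_of_mem_torsionFixing V _ (hT hh) Q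
  -- `φ(F) = φ(c₁)` and `c₁ φ(c₁) = φ(c₁)`
  have hφF : φ.1 (δ * γ * δ⁻¹) = φ.1 c₁ := by
    rw [hFct, hcoc, hφT t₁ ht₁T, smul_zero, add_zero]
  have h2t : ∀ R : geomTorsion V (2 : ℤ), R + R = 0 := fun R ↦ by
    rw [← two_nsmul]; exact AddSubgroup.torsionBy.nsmul _
  have hφc₁ : c₁ • φ.1 c₁ = φ.1 c₁ := by
    have h := hcoc c₁ c₁
    rw [hc₁c₁, hφ1] at h
    -- `0 = φ c₁ + c₁ φ c₁`
    have h' : c₁ • φ.1 c₁ = -φ.1 c₁ := eq_neg_of_add_eq_zero_right h.symm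
    rw [h', neg_eq_iff_add_eq_zero, h2t]
  obtain ⟨Q, hQ⟩ := hcfix δ (φ.1 c₁) hφc₁
  -- `φ(F) = F Q − Q`
  have hFQ : (δ * γ * δ⁻¹) • Q = c₁ • Q := by rw [hFct, mul_smul, hfixT t₁ ht₁T Q]
  have hφF' : φ.1 (δ * γ * δ⁻¹) = (δ * γ * δ⁻¹) • Q - Q := by rw [hφF, hQ, hFQ]
  have hφFpow : ∀ k : ℕ, φ.1 ((δ * γ * δ⁻¹) ^ k) = (δ * γ * δ⁻¹) ^ k • Q - Q := by
    intro k
    induction k with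
    | zero => rw [pow_zero, hφ1, one_smul, sub_self]
    | succ k ih =>
      rw [pow_succ, hcoc, ih, hφF', smul_sub, ← mul_smul]
      abel
  -- `φ|_{G_𝔓}` is the coboundary of `Q`
  have hdec : ∀ d ∈ 𝔓w.decompositionSubgroup (absoluteGaloisGroup ℚ), φ.1 d = d • Q - Q := by
    intro d hd
    obtain ⟨k, i, u, hi, hu, rfl⟩ :=
      exists_eq_frobenius_pow_mul_of_mem_decompositionSubgroup h𝔓w hF hTopen hd
    have hiT : i ∈ T := hI 𝔐 h𝔐 hi
    rw [hcoc, hcoc, hφT u hu, smul_zero, add_zero, hφT i hiT, smul_zero, add_zero, hφFpow, mul_smul,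
      mul_smul, hfixT u hu Q, hfixT i hiT Q]
  -- conclude via the cocycle criterion for `torsionLocalKer`
  have hclass : oneCocycleClass _ φ = x := oneCocycleClass_reprCocycle V _ x
  have hker : x ∈ V.torsionLocalKer (v.adicCompletion ℚ) (2 : ℤ) ↔
      ∃ Q' : AddSubgroup.torsionBy (localPoints V (v.adicCompletion ℚ)) (2 : ℤ),
        ∀ g : absoluteGaloisGroup (v.adicCompletion ℚ),
          torsionPointsMap V (v.adicCompletion ℚ) (2 : ℤ)
            (φ.1 (resGal (K := ℚ) (v.adicCompletion ℚ) g)) = g • Q' - Q' := by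
    rw [← hclass]
    exact oneCocycleClass_mem_resKer_iff _ _ _ φ
  refine hker.mpr ⟨torsionPointsMap V (v.adicCompletion ℚ) (2 : ℤ) Q, fun g ↦ ?_⟩
  have hd : resGal (K := ℚ) (v.adicCompletion ℚ) g ∈ 𝔓w.decompositionSubgroup (absoluteGaloisGroup ℚ) := by
    rw [resGal_eq]; exact resGalOfEmb_mem_decompositionSubgroup ι₀ h𝔐 g
  rw [hdec _ hd, map_sub, torsionPointsMap_smul]

end Local

/-! ## §32 Over `ℚ` at a depth-`M` Kolyvagin prime: classes of a twist dying on `Γ_{ℚ(E[2^M])}` are strict at `ℓ` -/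

section DepthStrict

variable (W : WeierstrassCurve ℚ) [W.IsElliptic] {K : Type} [Field K] [NumberField K]

/-- **ENTANGLED ⟹ STRICT at every depth-`M` Kolyvagin prime.** `W/ℚ` elliptic, `Wd` any elliptic model of a quadratic twist
`W^{(d)}` (`d ≠ 0`; `d = 1`-type models of `W` itself included via `C • W = Wd`) with `Δ_{Wd} < 0`, `M ≥ 1`, `ℓ` an odd prime
of good reduction for `W` with `Frob_ℓ = Frob_∞` on `K(E[2^M])` (`FrobEqFrobInfty W K (2^M) ℓ`: a depth-`M` Kolyvagin prime of
the frame `(E, K)`). If a class `x ∈ H¹(ℚ, Wd[2])` DIES on `Γ_{ℚ(E[2^M])}` — `[x, h] = 0` for all `h` fixing `E[2^M]`, the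
NEGATION of the non-entanglement hypothesis of g8's `exists_kolyvaginPrime_pow_not_mem_torsionLocalKer_twin` — then `x_ℓ = 0`
in `H¹(ℚ_ℓ, Wd[2])`. (§31 with `T = Γ_{ℚ(E[2^M])}` — open, normal, `≤ Γ_{ℚ(E[2])} = Γ_{ℚ(Wd[2])}`, containing the inertia at
the good odd prime `ℓ` — and `c =` complex conjugation, a transposition on `Wd[2]` since `Δ_{Wd} < 0`.) So the twin-side
hypothesis of the depth-`M` supply is not only sufficient but NECESSARY for `x_ℓ ≠ 0` at some depth-`M` prime.
[cite: GrossLMS1991, §3 (3.1)–(3.3), §9 Prop. 9.6] [cite: MazurRubin2010, Def. 3.1, Lemma 3.5] [cite: LawsonWuthrich2016, Lemma 6] -/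
theorem mem_torsionLocalKer_of_forall_torsionFixing_pow_h1Eval_eq_zero
    {d : ℚ} (hd : d ≠ 0) {Wd : WeierstrassCurve ℚ} [Wd.IsElliptic] {C : VariableChange ℚ}
    (hWd : C • W.quadraticTwist d = Wd) (hΔd : Wd.Δ < 0) {M : ℕ} (hM : 1 ≤ M)
    {ℓ : ℕ} [Fact ℓ.Prime] (hℓ2 : ℓ ≠ 2) (hℓN : ¬ ℓ ∣ W.conductorNorm ℤ) (hFrob : FrobEqFrobInfty W K (2 ^ M) ℓ)
    {x : galH1Torsion Wd (2 : ℤ)} (hx : ∀ h ∈ torsionFixing W ((2 ^ M : ℕ) : ℤ), h1Eval Wd (2 : ℤ) x h = 0) :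
    x ∈ Wd.torsionLocalKer ℚ_[ℓ] (2 : ℤ) := by
  classical
  have hℓ : ℓ.Prime := Fact.out
  obtain ⟨v, 𝔓₀, γ, c₀, hℓv, h𝔓₀, hγ, hc₀, hγE, -⟩ := hFrob
  have hnM0 : ((2 ^ M : ℕ) : ℤ) ≠ 0 := by exact_mod_cast pow_ne_zero M two_ne_zero
  -- `T = Γ_{ℚ(E[2^M])}`
  set T := torsionFixing W ((2 ^ M : ℕ) : ℤ) with hTdef
  have hTopen : IsOpen (T : Set (absoluteGaloisGroup ℚ)) := isOpen_torsionFixing W hnM0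
  have h2M : (2 : ℤ) ∣ ((2 ^ M : ℕ) : ℤ) := by
    rw [Nat.cast_pow, Nat.cast_ofNat]; exact dvd_pow_self 2 (by omega : M ≠ 0)
  obtain ⟨ψ, hψ⟩ := exists_equivariant_addEquiv_geomTorsion_two_of_twist W hd hWd
  have hT : T ≤ torsionFixing Wd (2 : ℤ) :=
    (KolyvaginLowerBoundAtTwo.torsionFixing_le_of_dvd W h2M).trans
      (torsionFixing_le_of_equivariant_addEquiv Wd W (2 : ℤ) ψ hψ)
  -- the Frobenius `γ = c₀ · (c₀⁻¹ γ)` with `c₀⁻¹ γ ∈ T`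
  have hct : c₀⁻¹ * γ ∈ T := by
    rw [hTdef, mem_torsionFixing_iff]
    intro P
    rw [mul_smul, hγE P, inv_smul_smul]
  have hcc : c₀ * c₀ = 1 := by have h := hc₀.sq_eq_one; rwa [sq] at h
  -- good reduction of `W` at `v`, so inertia fixes `E[2^M]`
  have hgood : W.HasGoodReductionAt v := by
    apply hasGoodReductionAt_of_not_dvd_conductorNorm W v
    rw [primesEquiv_eq_of_natCast_mem hℓ hℓv]; exact hℓN
  have hvbad : v ∉ W.badPlaces (𝓞 ℚ) := fun h ↦ h hgood
  have hℓ2M : ¬ ℓ ∣ 2 ^ M := fun h ↦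
    hℓ2 ((Nat.prime_dvd_prime_iff_eq hℓ Nat.prime_two).mp (hℓ.dvd_of_dvd_pow h))
  have hn : ((((2 ^ M : ℕ) : ℤ)) : 𝓞 ℚ) ∉ v.asIdeal := by
    rw [Int.cast_natCast]; exact natCast_not_mem_of_not_dvd hℓ hℓv hℓ2M
  have hI : ∀ 𝔐 ∈ v.localPrimesAbove,
      (v.primeBelow (closureEmb (K := ℚ) (v.adicCompletion ℚ)) 𝔐).inertia (absoluteGaloisGroup ℚ) ≤ T :=
    fun 𝔐 h𝔐 ↦ inertia_le_torsionFixing W hvbad hn _ h𝔐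
  -- §31 at `v`, then transport `ℚ_v ≅ ℚ_ℓ`
  have hloc := mem_torsionLocalKer_of_forall_h1Eval_eq_zero_of_frob Wd T hTopen hT hx h𝔓₀ hγ hcc hct
    (fun δ P hP ↦ exists_eq_smul_sub_of_smul_eq_of_Δ_neg_conj Wd hΔd hc₀ δ P hP) hI
  haveI : CharZero (v.adicCompletion ℚ) :=
    charZero_of_injective_algebraMap (algebraMap ℚ (v.adicCompletion ℚ)).injective
  have hpv : ((Rat.HeightOneSpectrum.primesEquiv (R := 𝓞 ℚ) v : Nat.Primes) : ℕ) = ℓ := primesEquiv_eq hℓ hℓv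
  subst hpv
  set θ : v.adicCompletion ℚ ≃+* ℚ_[((Rat.HeightOneSpectrum.primesEquiv (R := 𝓞 ℚ) v : Nat.Primes) : ℕ)] :=
    RingEquivClass.toRingEquiv (Rat.HeightOneSpectrum.adicCompletion.padicEquiv (R := 𝓞 ℚ) v) with hθ
  exact (mem_torsionLocalKer_padic_iff Wd θ (2 : ℤ) x).mpr hloc

/-- **The same in Mazur–Rubin's currency**: if EVERY `2`-Selmer class of `Wd` dies on `Γ_{ℚ(E[2^M])}` — the negation of the
twin-side hypothesis `hS'` of g8's `exists_kolyvaginPrime_pow_genusPair_selmer_of_cor34i` («some Selmer class of `Wd` does not die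
on `Γ_{ℚ(E[2^M])}`») — then `Sel₂(Wd)` is STRICT at every odd prime `ℓ ∤ N_W` with `FrobEqFrobInfty W K (2^M) ℓ`:
`Sel₂(Wd) ≤ MazurRubin2010.strictLocalKer Wd ℚ_ℓ 2`. [cite: MazurRubin2010, Def. 3.1, Prop. 3.3] [cite: GrossLMS1991, §9 Prop. 9.6] -/
theorem selmerGroup_le_strictLocalKer_of_forall_torsionFixing_pow_h1Eval_eq_zero
    {d : ℚ} (hd : d ≠ 0) {Wd : WeierstrassCurve ℚ} [Wd.IsElliptic] {C : VariableChange ℚ}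
    (hWd : C • W.quadraticTwist d = Wd) (hΔd : Wd.Δ < 0) {M : ℕ} (hM : 1 ≤ M)
    {ℓ : ℕ} [Fact ℓ.Prime] (hℓ2 : ℓ ≠ 2) (hℓN : ¬ ℓ ∣ W.conductorNorm ℤ) (hFrob : FrobEqFrobInfty W K (2 ^ M) ℓ)
    (hent : ∀ c ∈ Wd.selmerGroup 2, ∀ h ∈ torsionFixing W ((2 ^ M : ℕ) : ℤ), h1Eval Wd (2 : ℤ) c h = 0) :
    Wd.selmerGroup 2 ≤ MazurRubin2010.strictLocalKer Wd ℚ_[ℓ] 2 := fun c hc ↦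
  mem_torsionLocalKer_of_forall_torsionFixing_pow_h1Eval_eq_zero W hd hWd hΔd hM hℓ2 hℓN hFrob (hent c hc)

end DepthStrict

end Summit.BirchSwinnertonDyer.BirchSwinnertonDyer.Theorems.GenusKolyTwistingPrime

end
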